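import Mathlib
import HarnessLib
import Literature.Analysis.ODE.GrassmannConvexity
import Summits.ValiantsHypothesis.ValiantsHypothesis.Theorems.KPlusLogSqLawWeakLiftingTowerGraftWronskianGrassmannConvexity
import Summits.ValiantsHypothesis.ValiantsHypothesis.Theorems.KPlusLogSqLawWeakLiftingTowerGraftInflectionLawSizeOne

/-!
# Tower graft line — THE SIZE-ONE SECTOR OF THE INFLECTION CLASS LAW IS LINEAR (`≤ 2K − 4` log–log inflections of a `K`-nomial),
# conditionally on the Grassmann convexity theorem for `k = 2`

Helper file for LINE (B) `Cruxes/WeakLifting/Lines/tower_graft.lean` (crux `WeakLifting` = stmt-ValiantsHypothesis-19561; rung S4b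
`TowerGraftLawCorner`).  NO stub is claimed.  Hand g8 reduced S4b format by format to an INFLECTION CLASS LAW for `𝓘(A,E) = W(A·E, X·W(E,A))`
and hand g9 (`…InflectionLawSizeOne`) isolated its SIZE-ONE SECTOR: «`Z₊(W(g, θg)) ≤ 2^c (K − 1) + 2^c` for every real `K`-nomial `g`»
(`θ = X·d/dX`; the log–log inflections of `g`, i.e. the critical points of `θg/g`), recorded there as OPEN in general (Descartes gives only the
quadratic ceiling `2pn ≤ K²/2`; the guess `≤ K − 1` is false: a `6`-nomial with `6` inflections).  Since `θg = Σ sₗdₗX^{dₗ}` lives on the SAME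
support as `g`, `W(g, θg)` is a Wronskian of two `K`-nomials on a common support, and Conjecture W — a corollary of the PUBLISHED Grassmann
convexity theorem for `k = 2` [Saldanha–Shapiro–Shapiro, Mosc. Math. J. 21 (2021) 613–637, Theorem 1], tree fact
`Literature.Analysis.ODE.GrassmannConvexityTwo`, via `…WronskianGrassmannConvexity.conjectureWAt_of_grassmannConvexityTwo` (hand g13) — gives
the LINEAR bound:

* ★★ `card_posRoots_inflection_one_le_linear_of_grassmannConvexityTwo` — for every real `K`-nomial `g = Σ sₗ X^{dₗ}` on a strictly
  increasing support, `Z₊(W(g, θg)) ≤ 2K − 4` (conditionally on the cited theorem): the size-one sector of the inflection class law holds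
  with constant `c = 1` (`2K − 4 ≤ 2(K − 1)`);
* `card_posRoots_inflection_one_le_classShape_of_grassmannConvexityTwo` — the same in the class-law shape `≤ 2^1·(K − 1) + 2^1`.

HONEST FRAMING: conditional on a cited, unformalised theorem; the size-one sector only — nothing on the sectors `m + 1 ≥ 2` of the inflection
class law, on S4/S4b/S4d/S4f/S5/S5ᴸ, TowerB, `WeakLifting`, Conjecture B, `MatrixDescartes` (18050) or `VP ≠ VNP`.  Def-free.  Seat: prover
leafhand-val-kpluslogsqlaw-1 g13, `--supports stmt-ValiantsHypothesis-19561 --as helper`.  [cite: SaldanhaShapiroShapiro2021, Theorem 1; the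
size-one dictionary is g9's, the plug-in this work]
-/

-- `Summit.ValiantsHypothesis.ValiantsHypothesis.…` repeats a component by the D-0017 layout
-- (single-conjunct summit), which the `dupNamespace` linter flags; the name is mandated.
set_option linter.dupNamespace false
set_option autoImplicit false

namespace Summit.ValiantsHypothesis.ValiantsHypothesis.Theorems.KPlusLogSqLaw.TowerGraft

open Polynomial Finset
open scoped BigOperators Polynomial

namespace InflectionLaw

/-- ★★ **THE SIZE-ONE SECTOR OF THE INFLECTION CLASS LAW IS LINEAR**: a real `K`-nomial `g = Σ sₗ X^{dₗ}` (strictly increasing support)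
has at most `2K − 4` log–log inflections in `(0, ∞)`, i.e. `Z₊(W(g, θg)) ≤ 2K − 4` — conditionally on the Grassmann convexity theorem for
`k = 2`. [cite: SaldanhaShapiroShapiro2021, Theorem 1] (via Conjecture W; `θg` is a `K`-nomial on the same support) -/
theorem card_posRoots_inflection_one_le_linear_of_grassmannConvexityTwo (hGC : Literature.Analysis.ODE.GrassmannConvexityTwo)
    {K : ℕ} (s : Fin K → ℝ) (d : Fin K → ℕ) (hd : StrictMono d) :
    ((wronskian (∑ l, C (s l) * X ^ d l) (X * derivative (∑ l, C (s l) * X ^ d l))).roots.toFinset.filter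
      (fun x => 0 < x)).card ≤ 2 * K - 4 := by
  rw [X_mul_derivative_fewnomial]
  exact WronskianDevelopable.conjectureWAt_of_grassmannConvexityTwo hGC K s (fun l => s l * d l) d hd

/-- the same in the shape of the inflection class law, constant `c = 1`: `Z₊(W(g, θg)) ≤ 2^1·(K − 1) + 2^1`.
[cite: SaldanhaShapiroShapiro2021, Theorem 1] -/
theorem card_posRoots_inflection_one_le_classShape_of_grassmannConvexityTwo (hGC : Literature.Analysis.ODE.GrassmannConvexityTwo)
    {K : ℕ} (s : Fin K → ℝ) (d : Fin K → ℕ) (hd : StrictMono d) :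
    ((wronskian (∑ l, C (s l) * X ^ d l) (X * derivative (∑ l, C (s l) * X ^ d l))).roots.toFinset.filter
      (fun x => 0 < x)).card ≤ 2 ^ 1 * (K - 1) + 2 ^ 1 := by
  refine (card_posRoots_inflection_one_le_linear_of_grassmannConvexityTwo hGC s d hd).trans ?_
  omega

end InflectionLaw

end Summit.ValiantsHypothesis.ValiantsHypothesis.Theorems.KPlusLogSqLaw.TowerGraft
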